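import Summits.BirchSwinnertonDyer.BirchSwinnertonDyer.Theorems.ErratumRoadFiveEulerHalfPOnlyMultPotMultTwinAtFiveGenusKolyvaginPointsRC
import Summits.BirchSwinnertonDyer.BirchSwinnertonDyer.Theorems.ErratumRoadFiveEulerHalfGenusEprimeEngine
import HarnessLib

/-!
# Route `ErratumRoadFive`, crux `EulerHalfPOnlyMultPotMultTwinAtFive` (23444), line `genus`, stub S4♯ (`stub_genusEprimeKolyvaginDatumRC`):
# the currency `GenusKolyvaginEprimePointsR` from the printed Heegner-point facts BY NAME and TWO W-SIDE LABELS on the CM span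
# (seat `bsd-idea-9` g24, line owner; helper `--supports 23444 --as helper`)

THEOREMS ONLY (no definition, no named fact, no `sorry`). Companion of `GenusKolyvaginRC.genusKolyvaginPointsR_of_presentation` (p682645,
the S2 closer's helper) for the S4♯ currency of the registered line `Cruxes/EulerHalfPOnlyMultPotMultTwinAtFive/Lines/genus.lean` (v1.5).

WHAT. `genusKolyvaginEprimePointsR_of_presentation`: in the genus-transport presentation (`W = C₂ • (D • E′)^{(d₁)}` globally minimal,
`d_K = d₁d₂` a genus factorisation, datum `Dt` on `E′`, Birch orientation `β`, root `θ = √d₁ ∈ K[1]` with signs `s`, conductor-one point `y`,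
transported genus point `P ∈ W(K)`; `p ≥ 5`, `ρ̄_{W,p}` onto), GIVEN the printed facts (G1), (B5) `Nekovar2007.cmPoint_frobeniusCongruence`,
(B3) `GrossLMS1991.prop53_conj_pinned_birch` and `nonempty_modularParametrizationData` BY NAME, and TWO LABELS stated over the CM presentation
(level `m`, `E′`-point `Q` over `K[m]` mapping to the CM point of conductor `m`, root `ϑ′ = ±√d₁ ∈ K[m]`): (E′) `hE0W` — for every
`ℚ`-embedding `f : K[m] → K̄` and every `v ∣ p`, `n′ · f(Θ_{ϑ′} Q)` lies in the `E⁰`-receptacle of `W` at `v`; (D″) `hDivW` — at every guarded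
square-free level `m` (`IsKolyvaginPrime ∧ FrobEqFrobInfty` at `p^M`) Kolyvagin's derived point of `Θ_{ϑ′} Q` (any generators `g`, any
transversal `S`) is `p^{min(M,t)}`-divisible in `W(K[m])` — the body of `GenusKolyvaginEprimePointsR W p K ι P t n′` holds VERBATIM
(sign, lift, admissible stable modules, ring-class-rational points, `P_1 = P`, (E′) on every module, and at guarded square-free `m` the
eigen relation, McCallum's 4.4 switch, and `p^{M−t}` kills the class of `P_m`).

HOW. `subst` the presentation; build the bare family `Y(m) = Θ_{ϑ_m}(y_{E′}(m))` and its labels (B2)–(B5), (B3₀) EXACTLY as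
`GenusKolyvagin.genusKolyvaginPointsR_of_facts` (p675176); take for `B(m)` the subgroup of `W(K[m])` generated by the `Aut(K[m]/ℚ)`-translates
of `Y(m)` and of the pushed-up `Y(m/ℓ)` at the coprime levels (`Aut`-stable by construction) and run the two-module engine
`GenusSharpKolyvagin.hpointsEprime_of_shimuraLabels_kolyvaginGuarded` (p698102): `hBE0` follows from `hE0W` by closure induction (a translate
of a generator embedded by `emb` is `Y(k)` embedded by `emb ∘ τ₀ (∘ incl)`: `cases` on the point), `hDiv` is `hDivW` read at `Q = y_{E′}(m)`.

HONEST FRAMING: conditional on the four named facts and the two labels (hypotheses, displayed; the labels are the research content of S4♯ —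
(E′) is [GrossZagier1986 III (3.1)]-shaped, (D″) is Jetchev's divisibility read point-wise with `t` free). Nothing about `Ш`, no index, no
rank hypothesis enters; BSD is proved for no curve by this file.
[cite: GrossLMS1991, §§3–6 (Props. 3.7, 5.3, 6.2)] [cite: McCallumLMS1991, §4 (4)–(6), Prop. 4.4, Cor. 4.5] [cite: Nekovar2007, Prop. 4.9]
[cite: Darmon2004, Thm. 3.6] [cite: GrossZagier1986, III (3.1)] [cite: Jetchev2008, Thm. 1.4]
presearch: «genus character Heegner points Kolyvagin Néron component divisibility» → [corpus: GrossLMS1991 §§3–6, McCallumLMS1991 §4,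
Jetchev2008 Thm 1.4] untwisted shapes only; `lean search 'hpointsEprime_of_shimuraLabels'` → p698102 only.
-/

noncomputable section

open scoped Classical ComplexConjugate

set_option linter.dupNamespace false
set_option autoImplicit false

namespace Summit.BirchSwinnertonDyer.BirchSwinnertonDyer.Theorems.GenusKolyvagin

open WeierstrassCurve NumberField Field IsDedekindDomain Literature.NumberTheory.EllipticCurves
  Literature.NumberTheory.EllipticCurves.ModularForms Literature.NumberTheory.GaloisRepresentations
  Summit.BirchSwinnertonDyer.Rank1Residual.X11b

variable {K : Type} [Field K] [NumberField K]

set_option maxHeartbeats 1600000 in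
/-- **S4♯'s currency from the printed facts and the two CM-span labels (E′), (D″)** — see the module docstring.
[cite: GrossLMS1991, §§3–6] [cite: McCallumLMS1991, §4, Cor. 4.5] [cite: Nekovar2007, Prop. 4.9] [cite: Jetchev2008, Thm. 1.4] -/
theorem genusKolyvaginEprimePointsR_of_presentation
    (hG1 : ∀ (N : ℕ) [NeZero N] (W : WeierstrassCurve ℚ) (K : Type) [Field K] [NumberField K],
      phi_heegnerPointOfConductor_mem_range_map_ringClassField_birch N W K)
    (hNek : Nekovar2007.cmPoint_frobeniusCongruence)
    (hP53 : ∀ (N : ℕ) [NeZero N] (W : WeierstrassCurve ℚ) (K : Type) [Field K] [NumberField K],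
      GrossLMS1991.prop53_conj_pinned_birch N W K)
    (hmodP : nonempty_modularParametrizationData)
    (W : WeierstrassCurve ℚ) [W.IsElliptic] [W.IsGloballyMinimal] {p : ℕ} [Fact p.Prime] (hp5 : 5 ≤ p)
    (hsurj : W.HasSurjectiveModNGaloisRep p)
    (hK : IsImaginaryQuadratic K) (ι : K →+* ℂ)
    (E' : WeierstrassCurve ℚ) [E'.IsElliptic] [E'.IsGloballyMinimal] [NeZero (E'.conductorNorm ℤ)]
    (D C₂ : VariableChange ℚ) [(D • E').IsCharNeTwoNF] {d₁ d₂ : ℤ}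
    (hd₁s : (d₁ % 4 = 1 ∧ Squarefree d₁ ∧ d₁ ≠ 1) ∨ (4 ∣ d₁ ∧ (d₁ / 4 % 4 = 2 ∨ d₁ / 4 % 4 = 3) ∧ Squarefree (d₁ / 4)))
    (hd₂s : (d₂ % 4 = 1 ∧ Squarefree d₂ ∧ d₂ ≠ 1) ∨ (4 ∣ d₂ ∧ (d₂ / 4 % 4 = 2 ∨ d₂ / 4 % 4 = 3) ∧ Squarefree (d₂ / 4)))
    (hd : d₁ * d₂ = NumberField.discr K)
    (hE' : ∃ C : VariableChange ℚ, C • W.quadraticTwist (d₁ : ℚ) = E')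
    (hWd : C₂ • (D • E').quadraticTwist (d₁ : ℚ) = W)
    (Dt : ModularParametrizationData E' (E'.conductorNorm ℤ)) {β : ℤ}
    (hβ : (4 * (E'.conductorNorm ℤ : ℤ)) ∣ β ^ 2 - NumberField.discr K)
    {θ : ringClassField K ι 1} (hθ2 : θ ^ 2 = algebraMap ℚ (ringClassField K ι 1) (d₁ : ℚ)) (hθ0 : θ ≠ 0)
    (s : ringClassGal ι 1 → ℤˣ)
    (hθσ : ∀ σ : ringClassGal ι 1, σ.1 θ = ((s σ : ℤ) : ringClassField K ι 1) * θ)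
    {y : (E'.baseChange (ringClassField K ι 1)).toAffine.Point}
    (hy : Affine.Point.map (ringClassField K ι 1).subtype.toRatAlgHom y = heegnerPointComplexOfConductor Dt (NumberField.discr K) β 1)
    {instF : Fintype (ringClassGal ι 1)} {P : (W.baseChange K).toAffine.Point}
    (hP : Affine.Point.map (algebraMap K (ringClassField K ι 1)).toRatAlgHom P =
      Affine.Point.congrEquiv
        (congrArg (fun X : WeierstrassCurve ℚ ↦ X.baseChange (ringClassField K ι 1 : Type)) hWd)
        (VariableChange.pointEquivBaseChange ((D • E').quadraticTwist (d₁ : ℚ)) C₂ (ringClassField K ι 1)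
          ((VariableChange.pointEquiv (((D • E').quadraticTwist (d₁ : ℚ)).baseChange
              (ringClassField K ι 1 : Type)) (untwistAt hθ0)).symm
            ((Affine.Point.congrEquiv (untwistAt_smul_eq (D • E') hθ2 hθ0)).symm
              (VariableChange.pointEquivBaseChange E' D (ringClassField K ι 1)
                (∑ τ : ringClassGal ι 1,
                  (s τ : ℤ) • pointGalHom E' (ringClassField K ι 1 : Type) τ.1 y))))))
    (t : ℕ) (n' : ℤ)
    (hE0W : ∀ (m : ℕ), m ≠ 0 → ∀ (Q : (E'.baseChange (ringClassField K ι m)).toAffine.Point),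
      Affine.Point.map (ringClassField K ι m).subtype.toRatAlgHom Q =
        heegnerPointComplexOfConductor Dt (NumberField.discr K) β m →
      ∀ (ϑ' : ringClassField K ι m) (hϑ'2 : ϑ' ^ 2 = algebraMap ℚ (ringClassField K ι m) (d₁ : ℚ)) (hϑ'0 : ϑ' ≠ 0)
        (f : ringClassField K ι m →ₐ[ℚ] AlgebraicClosure K) (v : HeightOneSpectrum (𝓞 K)),
        ((p : ℕ) : 𝓞 K) ∈ v.asIdeal →
        n' • pointsMap (W.baseChange K) (v.adicCompletion K)
          (Affine.Point.map (W' := W) f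
            (Affine.Point.congrEquiv
              (congrArg (fun X : WeierstrassCurve ℚ ↦ X.baseChange (ringClassField K ι m : Type)) hWd)
              (VariableChange.pointEquivBaseChange ((D • E').quadraticTwist (d₁ : ℚ)) C₂ (ringClassField K ι m)
                ((VariableChange.pointEquiv (((D • E').quadraticTwist (d₁ : ℚ)).baseChange
                    (ringClassField K ι m : Type)) (untwistAt hϑ'0)).symm
                  ((Affine.Point.congrEquiv (untwistAt_smul_eq (D • E') hϑ'2 hϑ'0)).symm
                    (VariableChange.pointEquivBaseChange E' D (ringClassField K ι m) Q)))))) ∈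
          E0Receptacle (W.baseChange K) v)
    (hDivW : ∀ {M : ℕ}, 1 ≤ M → ∀ m : ℕ, Squarefree m →
      (∀ q ∈ m.primeFactors, IsKolyvaginPrime (W.conductorNorm ℤ) W K p q ∧ FrobEqFrobInfty W K (p ^ M) q) →
      ∀ (Q : (E'.baseChange (ringClassField K ι m)).toAffine.Point),
      Affine.Point.map (ringClassField K ι m).subtype.toRatAlgHom Q =
        heegnerPointComplexOfConductor Dt (NumberField.discr K) β m →
      ∀ (ϑ' : ringClassField K ι m) (hϑ'2 : ϑ' ^ 2 = algebraMap ℚ (ringClassField K ι m) (d₁ : ℚ)) (hϑ'0 : ϑ' ≠ 0)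
        (g : ℕ → (ringClassField K ι m ≃ₐ[ℚ] ringClassField K ι m))
        (S : Finset (ringClassField K ι m ≃ₐ[ℚ] ringClassField K ι m)),
        (∀ ℓ ∈ m.primeFactors, Subgroup.zpowers (g ℓ) = ringClassGalOver ι m (m / ℓ)) →
        (∀ u ∈ S, u ∈ ringClassGal ι m) →
        (∀ h ∈ ringClassGal ι m, ∃! u, u ∈ S ∧ h⁻¹ * u ∈ ringClassGalOver ι m 1) →
        ∃ z : (W.baseChange (ringClassField K ι m)).toAffine.Point,
          ((p ^ min M t : ℕ) : ℤ) • z =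
            KolyvaginOperator.derivedPoint (pointGalHom W (ringClassField K ι m)) g m S
              (Affine.Point.congrEquiv
                (congrArg (fun X : WeierstrassCurve ℚ ↦ X.baseChange (ringClassField K ι m : Type)) hWd)
                (VariableChange.pointEquivBaseChange ((D • E').quadraticTwist (d₁ : ℚ)) C₂ (ringClassField K ι m)
                  ((VariableChange.pointEquiv (((D • E').quadraticTwist (d₁ : ℚ)).baseChange
                      (ringClassField K ι m : Type)) (untwistAt hϑ'0)).symm
                    ((Affine.Point.congrEquiv (untwistAt_smul_eq (D • E') hϑ'2 hϑ'0)).symm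
                      (VariableChange.pointEquivBaseChange E' D (ringClassField K ι m) Q)))))) :
    ∀ {M : ℕ} (_hM : 1 ≤ M)
      (hdiv : ∀ Q : geomPoints (W.baseChange K), ∃ R, ((p ^ M : ℕ) : ℤ) • R = Q)
      (c : K ≃ₐ[ℚ] K) (_hc : c ≠ 1),
      ∃ (ε : ℤ) (τ : AlgebraicClosure K ≃+* AlgebraicClosure K) (hτ : IsLiftOfAut c τ)
        (A : ℕ → AddSubgroup (geomPoints (W.baseChange K)))
        (hA : ∀ m, KolyvaginCocycle.IsAdmissible (Field.absoluteGaloisGroup K) (A m) ((p ^ M : ℕ) : ℤ))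
        (emb : ∀ m : ℕ, ringClassField K ι m →ₐ[K] AlgebraicClosure K)
        (Pn : ℕ → geomPoints (W.baseChange K))
        (hPn : ∀ m, Pn m ∈ KolyvaginCocycle.invPoints (Field.absoluteGaloisGroup K) (A m) ((p ^ M : ℕ) : ℤ)),
        (ε = 1 ∨ ε = -1) ∧
        IsOfFinAddOrder (Affine.Point.map (W' := W) (c : K →ₐ[ℚ] K) P - ε • P) ∧
        (∀ m, ∀ a ∈ A m, hτ.pointsMap W a ∈ A m) ∧
        Pn 1 = toGeomPoints (W.baseChange K) P ∧
        (∀ m, m ≠ 0 → ∀ a ∈ A m, ∀ Φ : Field.absoluteGaloisGroup K,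
          (∀ x : ringClassField K ι m, Φ • emb m x = emb m x) → Φ • a = a) ∧
        (∀ m, ∀ a ∈ A m, ∀ v : HeightOneSpectrum (𝓞 K), ((p : ℕ) : 𝓞 K) ∈ v.asIdeal →
          n' • pointsMap (W.baseChange K) (v.adicCompletion K) a ∈ E0Receptacle (W.baseChange K) v) ∧
        (∀ m : ℕ, Squarefree m →
          (∀ q ∈ m.primeFactors, IsKolyvaginPrime (W.conductorNorm ℤ) W K p q ∧ FrobEqFrobInfty W K (p ^ M) q) →
          (∃ B ∈ A m, hτ.pointsMap W (Pn m) =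
            (ε * (-1) ^ m.primeFactors.card) • Pn m + ((p ^ M : ℕ) : ℤ) • B) ∧
          (∀ ℓ : ℕ, ℓ.Prime → ℓ ∣ m → ∀ v : HeightOneSpectrum (𝓞 K), (ℓ : 𝓞 K) ∈ v.asIdeal →
            ∀ a : ℕ, (((p : ℤ) ^ a) •
                kolyvaginClass (W.baseChange K) _ hdiv (hA m) (Pn m) (hPn m) ∈
                selmerLocalKer (W.baseChange K) (v.adicCompletion K) ((p ^ M : ℕ) : ℤ) ↔
              ((p : ℤ) ^ a) • kolyvaginClass (W.baseChange K) _ hdiv (hA (m / ℓ)) (Pn (m / ℓ)) (hPn (m / ℓ)) ∈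
                (W.baseChange K).torsionLocalKer (v.adicCompletion K) ((p ^ M : ℕ) : ℤ))) ∧
          ((p : ℤ) ^ (M - t)) • kolyvaginClass (W.baseChange K) _ hdiv (hA m) (Pn m) (hPn m) = 0) := by
  subst hWd
  have hD4 : NumberField.discr K < -4 := GenusKolyvaginRC.discr_lt_neg_four_of_genus hK hd₁s hd₂s hd
  have hd₁ : d₁ ∣ NumberField.discr K := hd ▸ dvd_mul_right d₁ d₂
  -- §0 basic data
  have hp : p.Prime := Fact.out
  have hp2 : p ≠ 2 := by omega
  haveI : NeZero ((C₂ • (D • E').quadraticTwist (d₁ : ℚ)).conductorNorm ℤ) := ⟨(WeierstrassCurve.conductorNorm_pos_holds _).ne'⟩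
  obtain ⟨DtW⟩ := hmodP (C₂ • (D • E').quadraticTwist (d₁ : ℚ))
  have hd10 : d₁ ≠ 0 := by
    rintro rfl
    exact hθ0 (pow_eq_zero_iff (n := 2) (by norm_num) |>.mp (by rw [hθ2]; simp))
  -- §1 the `E′` points over `K[m]` (named fact G1) — `0` off the coprime levels
  have hex : ∀ m : ℕ, m ≠ 0 → m.Coprime (E'.conductorNorm ℤ) →
      ∃ Q : (E'.baseChange (ringClassField K ι m)).toAffine.Point,
        Affine.Point.map (ringClassField K ι m).subtype.toRatAlgHom Q =
          heegnerPointComplexOfConductor Dt (NumberField.discr K) β m :=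
    fun m hm hmN => hG1 (E'.conductorNorm ℤ) E' K hK Dt β ι m hβ hm hmN
  obtain ⟨yE, hyEdef⟩ : ∃ yE : (m : ℕ) → (E'.baseChange (ringClassField K ι m)).toAffine.Point, ∀ m,
      yE m = if h : m ≠ 0 ∧ m.Coprime (E'.conductorNorm ℤ) then (hex m h.1 h.2).choose else 0 :=
    ⟨fun m => if h : m ≠ 0 ∧ m.Coprime (E'.conductorNorm ℤ) then (hex m h.1 h.2).choose else 0, fun _ => rfl⟩
  have hyE : ∀ m (hm : m ≠ 0) (hmN : m.Coprime (E'.conductorNorm ℤ)),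
      Affine.Point.map (ringClassField K ι m).subtype.toRatAlgHom (yE m) = heegnerPointComplexOfConductor Dt (NumberField.discr K) β m :=
    fun m hm hmN => by rw [hyEdef m, dif_pos (And.intro hm hmN)]; exact (hex m hm hmN).choose_spec
  have hyE0 : ∀ m, ¬ (m ≠ 0 ∧ m.Coprime (E'.conductorNorm ℤ)) → yE m = 0 := fun m h => by rw [hyEdef m, dif_neg h]
  -- §2 the pin of Prop. 5.3 and the sign `ε`
  obtain ⟨σ₁, hσ₁, H53⟩ := hP53 (E'.conductorNorm ℤ) E' K hK Dt β ι hβ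
  set u₁ : ℤ := (s ⟨σ₁, hσ₁⟩ : ℤ) with hu₁def
  have hu₁ : u₁ = 1 ∨ u₁ = -1 := by
    rcases Int.units_eq_one_or (s ⟨σ₁, hσ₁⟩) with h | h <;> first | (left; rw [hu₁def, h]; rfl) | (right; rw [hu₁def, h]; rfl)
  have hσ₁θ : σ₁ θ = ((u₁ : ℤ) : ringClassField K ι 1) * θ := hθσ ⟨σ₁, hσ₁⟩
  set uτ : ℤ := Int.sign d₁ with huτdef
  have huτ : uτ = 1 ∨ uτ = -1 := by
    rcases lt_or_gt_of_ne hd10 with h | h <;> first | exact Or.inr (Int.sign_eq_neg_one_of_neg h) | exact Or.inl (Int.sign_eq_one_of_pos h)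
  set ε : ℤ := -E'.rootNumber * uτ * u₁ with hεdef
  have hε : ε = 1 ∨ ε = -1 := by
    rcases WeierstrassCurve.rootNumber_eq_one_or E' with h1 | h1 <;> rcases huτ with h2 | h2 <;>
      rcases hu₁ with h3 | h3 <;> simp [hεdef, h1, h2, h3]
  -- §3 the roots `ϑ_m = χ(m)·θ↑`
  have h1m : ∀ m : ℕ, m ≠ 0 → ringClassField K ι 1 ≤ ringClassField K ι m := fun m hm => ringClassField_mono hK ι (one_dvd m) hm
  obtain ⟨χ, hχdef⟩ : ∃ χ : ℕ → ℤ, ∀ m, χ m = if jacobiSym d₁ m = -1 then -1 else 1 := ⟨_, fun _ => rfl⟩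
  have hχ : ∀ m, χ m = 1 ∨ χ m = -1 := fun m => by rw [hχdef]; exact levelSign_eq_one_or d₁ m
  obtain ⟨ϑ, hϑdef⟩ : ∃ ϑ : (m : ℕ) → m ≠ 0 → ringClassField K ι m, ∀ m (hm : m ≠ 0),
      ϑ m hm = ((χ m : ℤ) : ringClassField K ι m) * RingClassField.inclusion ι (h1m m hm) θ :=
    ⟨fun m hm => ((χ m : ℤ) : ringClassField K ι m) * RingClassField.inclusion ι (h1m m hm) θ, fun _ _ => rfl⟩
  have hϑ2 : ∀ m (hm : m ≠ 0), ϑ m hm ^ 2 = algebraMap ℚ (ringClassField K ι m) (d₁ : ℚ) :=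
    fun m hm => root_sq_eq ι (h1m m hm) (hχ m) hθ2 (hϑdef m hm)
  have hϑ0 : ∀ m (hm : m ≠ 0), ϑ m hm ≠ 0 := fun m hm => root_ne_zero ι (h1m m hm) (hχ m) hθ0 (hϑdef m hm)
  have hϑC : ∀ m (hm : m ≠ 0), (ϑ m hm : ℂ) = ((χ m : ℤ) : ℂ) * (θ : ℂ) :=
    fun m hm => coe_root ι (h1m m hm) (hϑdef m hm)
  -- §4 the bare family
  obtain ⟨Y, hYdef⟩ : ∃ Y : (m : ℕ) → ((C₂ • (D • E').quadraticTwist (d₁ : ℚ)).baseChange (ringClassField K ι m)).toAffine.Point,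
      ∀ m, Y m = if hm : m ≠ 0 then (VariableChange.pointEquivBaseChange ((D • E').quadraticTwist (d₁ : ℚ)) C₂ (ringClassField K ι m)
          ((VariableChange.pointEquiv (((D • E').quadraticTwist (d₁ : ℚ)).baseChange (ringClassField K ι m)) (untwistAt (hϑ0 m hm))).symm
            ((Affine.Point.congrEquiv (untwistAt_smul_eq (D • E') (hϑ2 m hm) (hϑ0 m hm))).symm
              (VariableChange.pointEquivBaseChange E' D (ringClassField K ι m) (yE m))))) else 0 :=
    ⟨fun m => if hm : m ≠ 0 then (VariableChange.pointEquivBaseChange ((D • E').quadraticTwist (d₁ : ℚ)) C₂ (ringClassField K ι m)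
          ((VariableChange.pointEquiv (((D • E').quadraticTwist (d₁ : ℚ)).baseChange (ringClassField K ι m)) (untwistAt (hϑ0 m hm))).symm
            ((Affine.Point.congrEquiv (untwistAt_smul_eq (D • E') (hϑ2 m hm) (hϑ0 m hm))).symm
              (VariableChange.pointEquivBaseChange E' D (ringClassField K ι m) (yE m))))) else 0, fun _ => rfl⟩
  have hY : ∀ m (hm : m ≠ 0), Y m = (VariableChange.pointEquivBaseChange ((D • E').quadraticTwist (d₁ : ℚ)) C₂ (ringClassField K ι m)
          ((VariableChange.pointEquiv (((D • E').quadraticTwist (d₁ : ℚ)).baseChange (ringClassField K ι m)) (untwistAt (hϑ0 m hm))).symm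
            ((Affine.Point.congrEquiv (untwistAt_smul_eq (D • E') (hϑ2 m hm) (hϑ0 m hm))).symm
              (VariableChange.pointEquivBaseChange E' D (ringClassField K ι m) (yE m))))) := fun m hm => by rw [hYdef m, dif_pos hm]
  have hY0 : ∀ m, ¬ (m ≠ 0 ∧ m.Coprime (E'.conductorNorm ℤ)) → Y m = 0 := fun m h => by
    by_cases hm : m = 0
    · rw [hYdef m, dif_neg (not_not.mpr hm)]
    · rw [hY m hm, hyE0 m h]; simp only [map_zero]
  -- §5 Kolyvagin-level bookkeeping
  have hlev : ∀ {m : ℕ}, Squarefree m → (∀ q ∈ m.primeFactors, IsKolyvaginPrime ((C₂ • (D • E').quadraticTwist (d₁ : ℚ)).conductorNorm ℤ) (C₂ • (D • E').quadraticTwist (d₁ : ℚ)) K p q) →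
      m.Coprime (E'.conductorNorm ℤ) ∧ d₁.gcd m = 1 ∧
      ∀ ℓ ∈ m.primeFactors, ℓ ≠ 2 ∧ (Ideal.span {(ℓ : 𝓞 K)}).IsPrime ∧ ¬ (ℓ : ℤ) ∣ d₁ ∧
        ¬ ℓ ∣ (C₂ • (D • E').quadraticTwist (d₁ : ℚ)).conductorNorm ℤ := by
    intro m hm hKol
    have hfacts : ∀ ℓ ∈ m.primeFactors, ℓ ≠ 2 ∧ (Ideal.span {(ℓ : 𝓞 K)}).IsPrime ∧ ¬ (ℓ : ℤ) ∣ d₁ ∧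
        ¬ ℓ ∣ (C₂ • (D • E').quadraticTwist (d₁ : ℚ)).conductorNorm ℤ := by
      intro ℓ hℓ; have hK' := hKol ℓ hℓ
      exact ⟨kolyvaginPrime_ne_two (C₂ • (D • E').quadraticTwist (d₁ : ℚ)) hp5 hp hK', hK'.2.2.2.2.1, fun h => hK'.2.2.1 (h.trans hd₁), hK'.2.1⟩
    refine ⟨?_, ?_, hfacts⟩
    · refine (ModularAuxNorm.coprime_of_forall_primeFactors_not_dvd hm.ne_zero fun r hr hrN => ?_).symm
      obtain ⟨hr2, -, hrd, hrW⟩ := hfacts r hr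
      haveI : Fact r.Prime := ⟨Nat.prime_of_mem_primeFactors hr⟩
      have hgoodW : (C₂ • (D • E').quadraticTwist (d₁ : ℚ)).HasGoodReductionAtPrime r :=
        not_not.mp (mt ((C₂ • (D • E').quadraticTwist (d₁ : ℚ)).dvd_conductorNorm_iff_not_hasGoodReductionAtPrime r).mpr hrW)
      have hgoodE := hasGoodReductionAtPrime_of_twist_presentation (C₂ • (D • E').quadraticTwist (d₁ : ℚ)) E' hE' hr2 hrd hgoodW
      exact (E'.dvd_conductorNorm_iff_not_hasGoodReductionAtPrime r).mp hrN hgoodE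
    · have hc : Nat.Coprime d₁.natAbs m := ModularAuxNorm.coprime_of_forall_primeFactors_not_dvd (N := d₁.natAbs) hm.ne_zero
        fun r hr hrd => (hfacts r hr).2.2.1 (Int.ofNat_dvd_left.mpr hrd)
      exact hc
  -- §6 label (B3) at every level `m ≠ 0`
  have hB3all : ∀ (m : ℕ), m ≠ 0 → ∀ τm : ringClassField K ι m ≃ₐ[ℚ] ringClassField K ι m,
      (∀ x : ringClassField K ι m, ((τm x : ringClassField K ι m) : ℂ) = conj (x : ℂ)) →
      ∃ σ' ∈ ringClassGal ι m, IsOfFinAddOrder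
        (pointGalHom (C₂ • (D • E').quadraticTwist (d₁ : ℚ)) (ringClassField K ι m) τm (Y m) - ε • pointGalHom (C₂ • (D • E').quadraticTwist (d₁ : ℚ)) (ringClassField K ι m) σ' (Y m)) := by
    intro m hm0 τm hτm
    by_cases hgood : m ≠ 0 ∧ m.Coprime (E'.conductorNorm ℤ)
    · obtain ⟨σ', hσ', hpin, hfin⟩ := H53 m hm0 hgood.2 (yE m) (hyE m hm0 hgood.2) τm hτm
      refine ⟨σ', hσ', ?_⟩; rw [hY m hm0]
      exact label_B3_level ι E' D C₂ d₁ (hϑ2 m hm0) (hϑ0 m hm0) huτ hu₁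
        (apply_root_eq_of_conj ι hθ2 hθ0 (hϑC m hm0) τm hτm)
        (apply_root_eq_of_pinned ι (hϑC m hm0) hpin hσ₁θ) hfin
    · refine ⟨1, one_mem _, ?_⟩
      rw [hY0 m hgood]; simp only [map_zero, smul_zero, sub_zero]; exact IsOfFinAddOrder.zero
  -- §7 label (B2)
  have hyE1 : yE 1 = y := Affine.Point.map_injective (f := (ringClassField K ι 1).subtype.toRatAlgHom)
    (by rw [hyE 1 one_ne_zero (Nat.coprime_one_left (E'.conductorNorm ℤ)), hy])
  have hϑ1 : ϑ 1 one_ne_zero = θ := by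
    apply Subtype.ext
    rw [hϑC 1 one_ne_zero, show χ 1 = 1 by rw [hχdef]; simp [jacobiSym.one_right]]; push_cast; ring
  have hB2 : ∀ T : Finset (ringClassField K ι 1 ≃ₐ[ℚ] ringClassField K ι 1),
      (∀ g, g ∈ T ↔ g ∈ ringClassGal ι 1) →
      Affine.Point.map (algebraMap K (ringClassField K ι 1)).toRatAlgHom P =
        ∑ g ∈ T, pointGalHom (C₂ • (D • E').quadraticTwist (d₁ : ℚ)) (ringClassField K ι 1) g (Y 1) := by
    intro T hT
    rw [hY 1 one_ne_zero, hyE1, twist_congr E' D C₂ d₁ (hϑ2 1 one_ne_zero) (hϑ0 1 one_ne_zero) hθ2 hθ0 hϑ1,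
      hP, Finset.sum_subtype T hT (fun g => pointGalHom (C₂ • (D • E').quadraticTwist (d₁ : ℚ)) (ringClassField K ι 1) g (VariableChange.pointEquivBaseChange ((D • E').quadraticTwist (d₁ : ℚ)) C₂ (ringClassField K ι 1)
          ((VariableChange.pointEquiv (((D • E').quadraticTwist (d₁ : ℚ)).baseChange (ringClassField K ι 1)) (untwistAt hθ0)).symm
            ((Affine.Point.congrEquiv (untwistAt_smul_eq (D • E') hθ2 hθ0)).symm
              (VariableChange.pointEquivBaseChange E' D (ringClassField K ι 1) y)))))]
    have key := twist_sum_smul_pointGalHom' E' D C₂ (d₁ : ℚ) hθ2 hθ0 (Finset.univ : Finset (ringClassGal ι 1))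
      (fun τ => τ.1) (fun τ => (s τ : ℤ)) (fun τ _ => by
        rcases Int.units_eq_one_or (s τ) with h | h
        · left; rw [h]; rfl
        · right; rw [h]; rfl) (fun τ _ => hθσ τ) y
    exact key
  -- §8 label (B3₀)
  have hB3K := ShimuraKolyvaginConjKLevel.isOfFinAddOrder_map_sub_smul_of_labels hK ι Y hB2 hB3all
  -- §8♯ the CM-span modules: the subgroup of `W(K[k])` generated by the `Aut(K[k]/ℚ)`-orbit of `Y k` and of the
  -- pushed-up `Y (k/ℓ)`; `Aut`-stable by construction; (E′) on it from `hE0W` by closure induction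
  obtain ⟨Bm, hBdef⟩ : ∃ Bm : ∀ k' : ℕ, AddSubgroup ((C₂ • (D • E').quadraticTwist (d₁ : ℚ)).baseChange (ringClassField K ι k')).toAffine.Point,
      ∀ k', Bm k' = AddSubgroup.closure {a | ∃ (τ' : ringClassField K ι k' ≃ₐ[ℚ] ringClassField K ι k')
        (x : ((C₂ • (D • E').quadraticTwist (d₁ : ℚ)).baseChange (ringClassField K ι k')).toAffine.Point),
        (((k' ≠ 0 ∧ k'.Coprime (E'.conductorNorm ℤ)) ∧ x = Y k') ∨
          ∃ ℓ ∈ k'.primeFactors, ∃ hle : ringClassField K ι (k' / ℓ) ≤ ringClassField K ι k',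
          (k' / ℓ ≠ 0 ∧ (k' / ℓ).Coprime (E'.conductorNorm ℤ)) ∧
          letI : Algebra K ℂ := ι.toAlgebra
          x = Affine.Point.map (W' := C₂ • (D • E').quadraticTwist (d₁ : ℚ))
            ((RingClassField.inclusion ι hle).restrictScalars ℚ) (Y (k' / ℓ))) ∧
        a = pointGalHom (C₂ • (D • E').quadraticTwist (d₁ : ℚ)) (ringClassField K ι k') τ' x} := ⟨_, fun _ => rfl⟩
  have hBgal : ∀ (k' : ℕ) (τ' : ringClassField K ι k' ≃ₐ[ℚ] ringClassField K ι k')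
      (a : ((C₂ • (D • E').quadraticTwist (d₁ : ℚ)).baseChange (ringClassField K ι k')).toAffine.Point),
      a ∈ Bm k' → pointGalHom (C₂ • (D • E').quadraticTwist (d₁ : ℚ)) (ringClassField K ι k') τ' a ∈ Bm k' := by
    intro k' τ' a ha; rw [hBdef k'] at ha ⊢
    refine AddSubgroup.closure_induction (fun x hx ↦ ?_) ?_ (fun x x' _ _ hx hx' ↦ ?_) (fun x _ hx ↦ ?_) ha
    · obtain ⟨τ₀, x₀, hx₀, rfl⟩ := hx
      exact AddSubgroup.subset_closure ⟨τ' * τ₀, x₀, hx₀, by rw [map_mul]; rfl⟩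
    · rw [map_zero]; exact zero_mem _
    · rw [map_add]; exact add_mem hx hx'
    · rw [map_neg]; exact neg_mem hx
  -- §9 labels (B4), (B5) in the guarded shape, the CM-span data, and the two-module engine
  intro M hM hdiv c hc
  refine GenusSharpKolyvagin.hpointsEprime_of_shimuraLabels_kolyvaginGuarded hK ι
    (W := (C₂ • (D • E').quadraticTwist (d₁ : ℚ))) rfl DtW hp hp2 hsurj Y hε hB2
    (fun m hm hKol τm hτm => hB3all m hm.ne_zero τm hτm) hB3K ?_ ?_ t n' Bm hBgal
    (fun k' ↦ by
      by_cases hg : k' ≠ 0 ∧ k'.Coprime (E'.conductorNorm ℤ)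
      · rw [hBdef k']; exact AddSubgroup.subset_closure ⟨1, Y k', Or.inl ⟨hg, rfl⟩, by rw [map_one]; rfl⟩
      · rw [hY0 k' hg]; exact zero_mem _)
    (fun k' ℓ hℓ hle ↦ by
      by_cases hg : k' / ℓ ≠ 0 ∧ (k' / ℓ).Coprime (E'.conductorNorm ℤ)
      · rw [hBdef k']; exact AddSubgroup.subset_closure ⟨1, _, Or.inr ⟨ℓ, hℓ, hle, hg, rfl⟩, by rw [map_one]; rfl⟩
      · rw [hY0 (k' / ℓ) hg, map_zero]; exact zero_mem _)
    (fun k' e _ jm hjm b hb v hv ↦ by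
      letI : Algebra K ℂ := ι.toAlgebra
      rw [hBdef k'] at hb
      refine AddSubgroup.closure_induction (fun x hx ↦ ?_) ?_ (fun x x' _ _ hx hx' ↦ ?_) (fun x _ hx ↦ ?_) hb
      · obtain ⟨τ₀, x₀, hx₀, rfl⟩ := hx
        rcases hx₀ with ⟨hg, rfl⟩ | ⟨ℓ, hℓ, hle, hg, rfl⟩
        · have hj' : jm (pointGalHom (C₂ • (D • E').quadraticTwist (d₁ : ℚ)) (ringClassField K ι k') τ₀ (Y k')) =
              Affine.Point.map (W' := C₂ • (D • E').quadraticTwist (d₁ : ℚ))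
                (e.toRatAlgHom.comp (τ₀ : ringClassField K ι k' →ₐ[ℚ] ringClassField K ι k')) (Y k') := by
            subst hjm; generalize Y k' = Q; cases Q <;> rfl
          rw [hj', hY k' hg.1]
          exact hE0W k' hg.1 (yE k') (hyE k' hg.1 hg.2) (ϑ k' hg.1) (hϑ2 k' hg.1) (hϑ0 k' hg.1) _ v hv
        · have hj' : jm (pointGalHom (C₂ • (D • E').quadraticTwist (d₁ : ℚ)) (ringClassField K ι k') τ₀
              (Affine.Point.map (W' := C₂ • (D • E').quadraticTwist (d₁ : ℚ))
                ((RingClassField.inclusion ι hle).restrictScalars ℚ) (Y (k' / ℓ)))) =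
              Affine.Point.map (W' := C₂ • (D • E').quadraticTwist (d₁ : ℚ))
                ((e.toRatAlgHom.comp (τ₀ : ringClassField K ι k' →ₐ[ℚ] ringClassField K ι k')).comp
                  ((RingClassField.inclusion ι hle).restrictScalars ℚ)) (Y (k' / ℓ)) := by
            subst hjm; generalize Y (k' / ℓ) = Q; cases Q <;> rfl
          rw [hj', hY (k' / ℓ) hg.1]
          exact hE0W (k' / ℓ) hg.1 (yE (k' / ℓ)) (hyE (k' / ℓ) hg.1 hg.2) (ϑ (k' / ℓ) hg.1) (hϑ2 (k' / ℓ) hg.1)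
            (hϑ0 (k' / ℓ) hg.1) _ v hv
      · rw [map_zero, map_zero, smul_zero]; exact zero_mem _
      · rw [map_add, map_add, smul_add]; exact add_mem hx hx'
      · rw [map_neg, map_neg, smul_neg]; exact neg_mem hx)
    (fun hM m hm hk g S h1 h2 h3 ↦ by
      rw [hY m hm.ne_zero]
      exact hDivW hM m hm hk (yE m) (hyE m hm.ne_zero (hlev hm fun q hq => (hk q hq).1).1) (ϑ m hm.ne_zero)
        (hϑ2 m hm.ne_zero) (hϑ0 m hm.ne_zero) g S h1 h2 h3) hM hdiv c hc
  · -- (B4)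
    intro m hm hKol ℓ hℓm hle σ hσ
    obtain ⟨hmN, hgcd, hfacts⟩ := hlev hm hKol
    obtain ⟨hℓ2, hinert, hℓd, hℓW⟩ := hfacts ℓ hℓm
    have hℓ : ℓ.Prime := Nat.prime_of_mem_primeFactors hℓm
    haveI : Fact ℓ.Prime := ⟨hℓ⟩
    have hm0 : m ≠ 0 := hm.ne_zero
    have hℓdvd : ℓ ∣ m := Nat.dvd_of_mem_primeFactors hℓm
    have hm'0 : m / ℓ ≠ 0 := fun h => hm0 (by rw [← Nat.mul_div_cancel' hℓdvd, h, mul_zero])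
    have hm'N : (m / ℓ).Coprime (E'.conductorNorm ℤ) := Nat.Coprime.coprime_dvd_left (Nat.div_dvd_of_dvd hℓdvd) hmN
    have hgoodW : (C₂ • (D • E').quadraticTwist (d₁ : ℚ)).HasGoodReductionAtPrime ℓ :=
      not_not.mp (mt ((C₂ • (D • E').quadraticTwist (d₁ : ℚ)).dvd_conductorNorm_iff_not_hasGoodReductionAtPrime ℓ).mpr hℓW)
    have hgoodE := hasGoodReductionAtPrime_of_twist_presentation (C₂ • (D • E').quadraticTwist (d₁ : ℚ)) E' hE' hℓ2 hℓd hgoodW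
    have hϑϑ' : (ϑ m hm0 : ℂ) = (legendreSym ℓ d₁ : ℂ) * (ϑ (m / ℓ) hm'0 : ℂ) := by
      rw [hϑC m hm0, hϑC (m / ℓ) hm'0, ← mul_assoc]
      congr 1; rw [hχdef m, hχdef (m / ℓ)]
      exact_mod_cast levelSign_eq_legendreSym_mul hℓdvd hm0 hgcd
    rw [hY m hm0, hY (m / ℓ) hm'0]
    exact label_B4_level hK ι hD4 E' D C₂ d₁ Dt hβ hm hℓm hℓ2 hinert hℓd hgoodW hgoodE hmN hle σ hσ
      (hϑ2 m hm0) (hϑ0 m hm0) (hϑ2 (m / ℓ) hm'0) (hϑ0 (m / ℓ) hm'0) hϑϑ' (hyE m hm0 hmN)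
      (hyE (m / ℓ) hm'0 hm'N)
  · -- (B5)
    intro m hm hKol ℓ hℓm _ hΔ φ₀ hφ₀ hle emb hemb j hj γ _
    obtain ⟨hmN, hgcd, hfacts⟩ := hlev hm hKol
    obtain ⟨hℓ2, hinert, hℓd, hℓW⟩ := hfacts ℓ hℓm
    have hℓ : ℓ.Prime := Nat.prime_of_mem_primeFactors hℓm
    have hm0 : m ≠ 0 := hm.ne_zero
    have hℓdvd : ℓ ∣ m := Nat.dvd_of_mem_primeFactors hℓm
    have hm'0 : m / ℓ ≠ 0 := fun h => hm0 (by rw [← Nat.mul_div_cancel' hℓdvd, h, mul_zero])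
    have hm'N : (m / ℓ).Coprime (E'.conductorNorm ℤ) := Nat.Coprime.coprime_dvd_left (Nat.div_dvd_of_dvd hℓdvd) hmN
    have hgoodW : (C₂ • (D • E').quadraticTwist (d₁ : ℚ)).HasGoodReductionAtPrime ℓ :=
      not_not.mp (mt ((C₂ • (D • E').quadraticTwist (d₁ : ℚ)).dvd_conductorNorm_iff_not_hasGoodReductionAtPrime ℓ).mpr hℓW)
    have hgoodE := hasGoodReductionAtPrime_of_twist_presentation (C₂ • (D • E').quadraticTwist (d₁ : ℚ)) E' hE' hℓ2 hℓd hgoodW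
    have hϑϑ' : (ϑ m hm0 : ℂ) = (legendreSym ℓ d₁ : ℂ) * (ϑ (m / ℓ) hm'0 : ℂ) := by
      rw [hϑC m hm0, hϑC (m / ℓ) hm'0, ← mul_assoc]
      congr 1; rw [hχdef m, hχdef (m / ℓ)]
      exact_mod_cast levelSign_eq_legendreSym_mul hℓdvd hm0 hgcd
    rw [hY m hm0, hY (m / ℓ) hm'0]
    exact label_B5_level hNek hK ι E' D C₂ d₁ Dt hβ hm hℓm hℓ2 hinert hℓd hgoodE hmN hΔ hle
      (hϑ2 m hm0) (hϑ0 m hm0) (hϑ2 (m / ℓ) hm'0) (hϑ0 (m / ℓ) hm'0) hϑϑ' (hyE m hm0 hmN)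
      (hyE (m / ℓ) hm'0 hm'N) hφ₀ emb j hj γ

end Summit.BirchSwinnertonDyer.BirchSwinnertonDyer.Theorems.GenusKolyvagin

end
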